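import Summits.Ventures.Crystal3D.Theorems.StickyWulffConstantTextureLiminfTexShadowCertificateDefs
import HarnessLib

/-!
# The adhesion hypothesis in CAPPED T-FORM: `BarlowAdhesionTCap` (σ arbitrary) and `BarlowAdhesionTCapFcc` (σ = const)
# (crux `NoReconstructionGain`, stmt-Ventures-19144, line K1; serves lane T's `stub_barlowAdhesionTCap`, crux `TextureLiminfV5`, stmt-Ventures-23912;
#  cf-p1 DECISION (clx) «ADHESION RE-LINED», 2026-08-29T08:12:53Z)

HONEST FRAMING. Venture `Summits/Ventures/Crystal3D` (cell `crystal3d-full`), route `route-Ventures-StickyWulffConstant`.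
DEFINITIONS ONLY (two `Prop`s); nothing is claimed about them here.  Rung F-C1 not moved.

`BarlowAdhesionT` (`…TexShadowAdhesionTDefs`, lane T v8.6) asks, for EVERY Hägg word `σ`, frame `L`, origin `s`, unit
normal `ν` and radius `ρ ≥ R`, that every finite packing `X` in the half-cylinder `{−2R ≤ ⟪p,ν⟫, ‖p‖² − ⟪p,ν⟫² ≤ ρ²}`
in which the clamped slab `{−2R ≤ ⟪p,ν⟫ ≤ −R}` of `stacking L s σ` is complete admits a finite set `Q` of VACANT
stacking sites with `#cross(P, X∖P) ≤ D(X∖P) + (#cross(P,Q) − D(Q)) + C·ρ`, `P := X ∩ stacking`.  K1 (the fcc crux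
`NoReconstructionGain`) delivers this for `σ = const` only with the rim constant `C·(1+h)·ρ`, `h` a cap on the
heights of the cell's balls (HOME/INBOX 2026-08-29T08:12:09Z: without a height cap the T-form is strictly stronger than
the crux on tall rough lattice parts — lattice-needle hosts).  Hence the two capped statements below:

* `BarlowAdhesionTCap` — `BarlowAdhesionT` with the extra binder `∀ h ≥ 0`, the extra hypothesis
  `∀ p ∈ X, ⟪p,ν⟫ ≤ h`, and the constant `C·(1+h)·ρ`; `σ` ARBITRARY (lane T's re-typed stub, v8.8; K1's re-lined
  deliverable over Barlow hosts — OPEN for `σ ≠ const`);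
* `BarlowAdhesionTCapFcc` — the same with `σ := constHagg` (fcc hosts, every frame, origin and normal); proved from
  `NoReconstructionGain` in `…NoReconstructionGainAdhesionTForm` (this seat).

WHAT THIS IS NOT: no proof of either statement here; `BarlowAdhesionTCap` for `σ ≠ const` is not a consequence of the fcc
crux (line conservation is an fcc-only mechanism); the uncapped `BarlowAdhesionT` is dropped from the line by (clx).
-/

noncomputable section

open scoped BigOperators InnerProductSpace ENNReal
open MeasureTheory Filter

namespace Summit.Ventures.Crystal3D.Cruxes.TextureLiminf.TexShadow

open Summit.Ventures.Crystal3D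
open Literature.MathematicalPhysics.StatisticalMechanics (IsHaggSeq constHagg contactDeficiency)

open scoped Classical in
/-- **One-plate adhesion for every Barlow substrate, CAPPED T-FORM** (plate := ALL lattice balls of the cell; cell
heights capped by `h`, rim constant `C·(1+h)·ρ`): for every Hägg word `σ`, frame `L`, origin `s`, unit normal `ν`,
cap `h ≥ 0` and radius `ρ ≥ R`, every finite packing `X` with `−2R ≤ ⟪p,ν⟫ ≤ h` and `‖p‖² − ⟪p,ν⟫² ≤ ρ²` on `X` in
which the clamped slab `{−2R ≤ ⟪p,ν⟫ ≤ −R}` of `stacking L s σ` is complete admits a finite set `Q` of vacant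
stacking sites with `#cross(P, X∖P) ≤ D(X∖P) + (#cross(P,Q) − D(Q)) + C·(1+h)·ρ`, `P := X ∩ stacking L s σ`. -/
def BarlowAdhesionTCap : Prop :=
  ∃ R C : ℝ, 1 ≤ R ∧ ∀ σ : ℤ → ℤ, IsHaggSeq σ → ∀ (L : E3 ≃ₗᵢ[ℝ] E3) (s ν : E3), ‖ν‖ = 1 →
    ∀ h : ℝ, 0 ≤ h → ∀ ρ : ℝ, R ≤ ρ → ∀ X : Finset E3,
    (∀ p ∈ X, ∀ q ∈ X, p ≠ q → 1 ≤ dist p q) →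
    (∀ p ∈ X, -(2 * R) ≤ ⟪p, ν⟫_ℝ ∧ ‖p‖ ^ 2 - ⟪p, ν⟫_ℝ ^ 2 ≤ ρ ^ 2) →
    (∀ p ∈ X, ⟪p, ν⟫_ℝ ≤ h) →
    (∀ p ∈ stacking L s σ, -(2 * R) ≤ ⟪p, ν⟫_ℝ → ⟪p, ν⟫_ℝ ≤ -R → ‖p‖ ^ 2 - ⟪p, ν⟫_ℝ ^ 2 ≤ ρ ^ 2 → p ∈ X) →
    ∃ Q : Finset E3, (↑Q : Set E3) ⊆ stacking L s σ ∧ Disjoint Q X ∧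
      ((((X.filter fun p => p ∈ stacking L s σ) ×ˢ (X.filter fun p => p ∉ stacking L s σ)).filter
          fun pq => dist pq.1 pq.2 = 1).card : ℝ) ≤
        contactDeficiency (X.filter fun p => p ∉ stacking L s σ) +
          ((((((X.filter fun p => p ∈ stacking L s σ) ×ˢ Q).filter fun pq => dist pq.1 pq.2 = 1).card : ℕ) : ℝ) -
            contactDeficiency Q) +
          C * (1 + h) * ρ

open scoped Classical in
/-- **Capped T-form adhesion for fcc hosts** (`σ := constHagg`: the stacking is a rigidly moved copy `L Λ₀ + s` of
the fcc lattice; every frame, origin, unit normal, cap and radius).  Proved from the crux `NoReconstructionGain` in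
`…NoReconstructionGainAdhesionTForm`. -/
def BarlowAdhesionTCapFcc : Prop :=
  ∃ R C : ℝ, 1 ≤ R ∧ ∀ (L : E3 ≃ₗᵢ[ℝ] E3) (s ν : E3), ‖ν‖ = 1 →
    ∀ h : ℝ, 0 ≤ h → ∀ ρ : ℝ, R ≤ ρ → ∀ X : Finset E3,
    (∀ p ∈ X, ∀ q ∈ X, p ≠ q → 1 ≤ dist p q) →
    (∀ p ∈ X, -(2 * R) ≤ ⟪p, ν⟫_ℝ ∧ ‖p‖ ^ 2 - ⟪p, ν⟫_ℝ ^ 2 ≤ ρ ^ 2) →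
    (∀ p ∈ X, ⟪p, ν⟫_ℝ ≤ h) →
    (∀ p ∈ stacking L s constHagg, -(2 * R) ≤ ⟪p, ν⟫_ℝ → ⟪p, ν⟫_ℝ ≤ -R → ‖p‖ ^ 2 - ⟪p, ν⟫_ℝ ^ 2 ≤ ρ ^ 2 →
      p ∈ X) →
    ∃ Q : Finset E3, (↑Q : Set E3) ⊆ stacking L s constHagg ∧ Disjoint Q X ∧
      ((((X.filter fun p => p ∈ stacking L s constHagg) ×ˢ
            (X.filter fun p => p ∉ stacking L s constHagg)).filter
          fun pq => dist pq.1 pq.2 = 1).card : ℝ) ≤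
        contactDeficiency (X.filter fun p => p ∉ stacking L s constHagg) +
          ((((((X.filter fun p => p ∈ stacking L s constHagg) ×ˢ Q).filter
              fun pq => dist pq.1 pq.2 = 1).card : ℕ) : ℝ) - contactDeficiency Q) +
          C * (1 + h) * ρ

/-- The general capped T-form specialises to fcc hosts (pure logic: `σ := constHagg`). -/
theorem barlowAdhesionTCapFcc_of_cap (hT : BarlowAdhesionTCap) : BarlowAdhesionTCapFcc := by
  obtain ⟨R, C, hR, hT⟩ := hT
  exact ⟨R, C, hR, fun L s ν hν => hT constHagg
    Literature.MathematicalPhysics.StatisticalMechanics.isHaggSeq_const L s ν hν⟩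

end Summit.Ventures.Crystal3D.Cruxes.TextureLiminf.TexShadow

end
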